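import Literature.Analysis.FluidPDE.CKNEpsilonRegularityAssembly
import Literature.Analysis.FluidPDE.LocalTypeIScaling
import Literature.Analysis.FluidPDE.SuitableWeakRescaling
import HarnessLib

/-!
# Navier–Stokes scaling of `D`, `F_q` and of the local-energy estimate (reduction to unit scale)

Analysis/FluidPDE file in the decomposition of the named fact
`Literature.Analysis.FluidPDE.ckn_epsilon_regularity` (`PartialRegularity.lean`, ns.S12:
Caffarelli–Kohn–Nirenberg 1982, Proposition 2), towards the decomposition target
`Literature.Analysis.FluidPDE.localEnergyEstimate` (`CKNEpsilonRegularityAssembly.lean`; Robinson–Rodrigo–Sadowski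
2016, (16.13)). Robinson–Rodrigo–Sadowski prove (16.13) and Lemma 16.7 "with `r = 1`, the result
for general `r` following by rescaling" (p. 252); this file supplies that rescaling in the
accepted vocabulary:

* `cknD_nsZoom`, `cknF_nsZoom` — invariance of the scaled pressure quantity
  `D(r) = r⁻² ∫∫_{Q_r} |p|^{3/2}` and of the scaled force quantity `F_q(r) = r^{3q-5} ∫∫_{Q_r} |f|^q`
  under the Navier–Stokes zoom `p ↦ c² p ∘ Φ`, `f ↦ c³ f ∘ Φ`, `Φ(s, y) = (t₀ + c² s, x₀ + c y)`
  (companions of the accepted `cknC_nsZoom`, `cknE_nsZoom`, `cknAEss_nsZoom` of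
  `LocalTypeIScaling.lean`);
* `MemLp.smul_uncurry_stPull` — the force class `f ∈ L^q(Q)` is transported to `Φ⁻¹(Q)`;
* `closure_parabolicCylinder_one_subset_stPreimage` — `closure Q₁(0) ⊆ Φ⁻¹(Q)` when
  `closure Q_r(z) ⊆ Q`, `Φ = stAffine r² r t x` for `z = (t, x)`;
* `localEnergyEstimate_of_unitScale` — **the local-energy estimate follows from its case
  `r = 1`, `z = 0`** (the hypothesis is the unit-scale statement, spelled out): apply
  the unit-scale estimate to the zoomed suitable weak solution
  (`IsSuitableWeakSolutionOn.stRescale` with `α = γ = r`, `β = r²`, viscosity unchanged) and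
  transport all quantities back.

## References

* J. C. Robinson, J. L. Rodrigo, W. Sadowski, *The three-dimensional Navier–Stokes equations*
  (2016), proof of Thm. 16.1, (16.13), and p. 252 ("the result for general `r` following by
  rescaling").
* L. Caffarelli, R. Kohn, L. Nirenberg, *Partial regularity of suitable weak solutions of the
  Navier–Stokes equations*, Comm. Pure Appl. Math. 35 (1982), §2 (scaling of (2.1)–(2.5)).
-/

noncomputable section

open MeasureTheory Set Function Filter TopologicalSpace Metric Module
open scoped NNReal ENNReal InnerProductSpace RealInnerProductSpace Topology

namespace Literature.Analysis.FluidPDE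

section Zoom

variable {c t₀ r : ℝ} {x₀ : EuclideanSpace ℝ (Fin 3)}

/-- **Scale invariance of `D`**: `D(c² q ∘ Φ; Q(z, r)) = D(q; Q(Φ z, c r))`. [folklore] -/
theorem cknD_nsZoom (hc : 0 < c) (hr : 0 < r) (t₀ : ℝ) (x₀ : EuclideanSpace ℝ (Fin 3))
    (z : ℝ × EuclideanSpace ℝ (Fin 3)) (q : ℝ → EuclideanSpace ℝ (Fin 3) → ℝ) :
    cknD r z ((c ^ 2 • stPull (c ^ 2) c t₀ x₀ q)) = cknD (c * r) (stAffine (c ^ 2) c t₀ x₀ z) q := by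
  have hc2 : 0 < c ^ 2 := by positivity
  unfold cknD
  rw [← LocalTypeIScaling.stAffine_preimage_parabolicCylinder hc t₀ x₀ r z]
  have hF : (fun w : ℝ × EuclideanSpace ℝ (Fin 3) =>
      ‖(c ^ 2 • stPull (c ^ 2) c t₀ x₀ q) w.1 w.2‖ₑ ^ (3 / 2 : ℝ)) =
      fun w => (fun w' : ℝ × EuclideanSpace ℝ (Fin 3) => ENNReal.ofReal c ^ (3 : ℕ) *
        ‖q w'.1 w'.2‖ₑ ^ (3 / 2 : ℝ)) (stAffine (c ^ 2) c t₀ x₀ w) := by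
    funext w
    simp only [Pi.smul_apply, stPull_apply, smul_eq_mul, stAffine_fst, stAffine_snd]
    rw [enorm_mul, ENNReal.mul_rpow_of_nonneg _ _ (by norm_num : (0:ℝ) ≤ 3 / 2),
      Real.enorm_eq_ofReal hc2.le, ENNReal.ofReal_rpow_of_nonneg hc2.le (by norm_num),
      sq_rpow_threeHalves hc.le, ENNReal.ofReal_pow hc.le]
  rw [show (∫⁻ w in stAffine (c ^ 2) c t₀ x₀ ⁻¹' parabolicCylinder (c * r) (stAffine (c ^ 2) c t₀ x₀ z),
      ‖(c ^ 2 • stPull (c ^ 2) c t₀ x₀ q) w.1 w.2‖ₑ ^ (3 / 2 : ℝ)) =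
      ∫⁻ w in stAffine (c ^ 2) c t₀ x₀ ⁻¹' parabolicCylinder (c * r) (stAffine (c ^ 2) c t₀ x₀ z),
        (fun w' : ℝ × EuclideanSpace ℝ (Fin 3) => ENNReal.ofReal c ^ (3 : ℕ) *
          ‖q w'.1 w'.2‖ₑ ^ (3 / 2 : ℝ)) (stAffine (c ^ 2) c t₀ x₀ w) from by rw [hF]]
  rw [setLIntegral_preimage_comp_stAffine (E := EuclideanSpace ℝ (Fin 3)) hc2 hc t₀ x₀
      (fun w' : ℝ × EuclideanSpace ℝ (Fin 3) => ENNReal.ofReal c ^ (3 : ℕ) * ‖q w'.1 w'.2‖ₑ ^ (3 / 2 : ℝ))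
      (parabolicCylinder (c * r) (stAffine (c ^ 2) c t₀ x₀ z)), finrank_euclideanSpace_fin,
    lintegral_const_mul' _ _ (by simp), ← mul_assoc (ENNReal.ofReal (c ^ 2 * c ^ 3)⁻¹),
    ← mul_assoc, scaleConst_sq hc hr]

/-- Bookkeeping of the scaling constants for `F_q` (`r^{3q-5}`-normalised, integrand of weight
`c^{3q}`): `r^{3q-5} · (c² c³)⁻¹ · (c³)^q = (c r)^{3q-5}` in `ℝ≥0∞`. [folklore] -/
theorem scaleConst_force (hc : 0 < c) (hr : 0 < r) {q : ℝ} (hq : 0 ≤ q) :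
    ENNReal.ofReal (r ^ (3 * q - 5)) * (ENNReal.ofReal (c ^ 2 * c ^ 3)⁻¹ *
      ENNReal.ofReal (c ^ 3) ^ q) = ENNReal.ofReal ((c * r) ^ (3 * q - 5)) := by
  have hc3 : 0 < c ^ 3 := by positivity
  rw [ENNReal.ofReal_rpow_of_nonneg hc3.le hq, ← ENNReal.ofReal_mul (by positivity),
    ← ENNReal.ofReal_mul (by positivity)]
  congr 1
  have e1 : (c ^ 3 : ℝ) ^ q = c ^ (3 * q) := by
    rw [← Real.rpow_natCast c 3, ← Real.rpow_mul hc.le]; norm_num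
  have e2 : (c ^ 2 * c ^ 3 : ℝ)⁻¹ = c ^ (-(5 : ℝ)) := by
    rw [Real.rpow_neg hc.le, show c ^ 2 * c ^ 3 = c ^ (5 : ℕ) by ring]
    norm_cast
  have e3 : (c * r) ^ (3 * q - 5) = c ^ (3 * q - 5) * r ^ (3 * q - 5) := Real.mul_rpow hc.le hr.le
  have e4 : c ^ (-(5 : ℝ)) * c ^ (3 * q) = c ^ (3 * q - 5) := by
    rw [← Real.rpow_add hc]; congr 1; ring
  rw [e1, e2, e3, ← e4]
  ring

/-- **Scale invariance of `F_q`**: `F_q(c³ f ∘ Φ; Q(z, r)) = F_q(f; Q(Φ z, c r))` for `q ≥ 0`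
(Caffarelli–Kohn–Nirenberg 1982, §2: `f_λ(x, t) = λ³ f(λx, λ²t)` and `∫∫_{Q_1} |f_λ|^q = λ^{3q-5} ∫∫_{Q_λ} |f|^q`).
[cite: CaffarelliKohnNirenberg1982, §2] -/
theorem cknF_nsZoom (hc : 0 < c) (hr : 0 < r) {q : ℝ} (hq : 0 ≤ q) (t₀ : ℝ)
    (x₀ : EuclideanSpace ℝ (Fin 3)) (z : ℝ × EuclideanSpace ℝ (Fin 3))
    (f : ℝ → EuclideanSpace ℝ (Fin 3) → EuclideanSpace ℝ (Fin 3)) :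
    cknF q r z ((c ^ 3 • stPull (c ^ 2) c t₀ x₀ f)) = cknF q (c * r) (stAffine (c ^ 2) c t₀ x₀ z) f := by
  have hc2 : 0 < c ^ 2 := by positivity
  have hc3 : 0 < c ^ 3 := by positivity
  unfold cknF
  rw [← LocalTypeIScaling.stAffine_preimage_parabolicCylinder hc t₀ x₀ r z]
  have hF : (fun w : ℝ × EuclideanSpace ℝ (Fin 3) =>
      ‖(c ^ 3 • stPull (c ^ 2) c t₀ x₀ f) w.1 w.2‖ₑ ^ q) =
      fun w => (fun w' : ℝ × EuclideanSpace ℝ (Fin 3) => ENNReal.ofReal (c ^ 3) ^ q *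
        ‖f w'.1 w'.2‖ₑ ^ q) (stAffine (c ^ 2) c t₀ x₀ w) := by
    funext w
    simp only [Pi.smul_apply, stPull_apply, stAffine_fst, stAffine_snd]
    rw [enorm_smul, ENNReal.mul_rpow_of_nonneg _ _ hq, Real.enorm_eq_ofReal hc3.le]
  rw [show (∫⁻ w in stAffine (c ^ 2) c t₀ x₀ ⁻¹' parabolicCylinder (c * r) (stAffine (c ^ 2) c t₀ x₀ z),
      ‖(c ^ 3 • stPull (c ^ 2) c t₀ x₀ f) w.1 w.2‖ₑ ^ q) =
      ∫⁻ w in stAffine (c ^ 2) c t₀ x₀ ⁻¹' parabolicCylinder (c * r) (stAffine (c ^ 2) c t₀ x₀ z),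
        (fun w' : ℝ × EuclideanSpace ℝ (Fin 3) => ENNReal.ofReal (c ^ 3) ^ q *
          ‖f w'.1 w'.2‖ₑ ^ q) (stAffine (c ^ 2) c t₀ x₀ w) from by rw [hF]]
  rw [setLIntegral_preimage_comp_stAffine (E := EuclideanSpace ℝ (Fin 3)) hc2 hc t₀ x₀
      (fun w' : ℝ × EuclideanSpace ℝ (Fin 3) => ENNReal.ofReal (c ^ 3) ^ q * ‖f w'.1 w'.2‖ₑ ^ q)
      (parabolicCylinder (c * r) (stAffine (c ^ 2) c t₀ x₀ z)), finrank_euclideanSpace_fin,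
    lintegral_const_mul' _ _ (ENNReal.rpow_ne_top_of_nonneg hq ENNReal.ofReal_ne_top),
    ← mul_assoc (ENNReal.ofReal (c ^ 2 * c ^ 3)⁻¹), ← mul_assoc, scaleConst_force hc hr hq]

end Zoom

section Transport

variable {E : Type*} [NormedAddCommGroup E] [InnerProductSpace ℝ E] [FiniteDimensional ℝ E]
  [MeasurableSpace E] [BorelSpace E]

/-- **The `L^q` class of the force is transported by the zoom**: if `f ∈ L^q(Q)` then
`a • f ∘ Φ ∈ L^q(Φ⁻¹ Q)`, `Φ(s, y) = (t₀ + β s, x₀ + γ y)`, `β, γ > 0` (change of variables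
`ds dy = (β γⁿ)⁻¹ dt dx`; Caffarelli–Kohn–Nirenberg 1982, §2). [cite: CaffarelliKohnNirenberg1982, §2] -/
theorem _root_.MeasureTheory.MemLp.smul_uncurry_stPull {F : Type*} [NormedAddCommGroup F]
    [NormedSpace ℝ F] {β γ : ℝ} (hβ : 0 < β) (hγ : 0 < γ) (t₀ : ℝ) (x₀ : E) (a : ℝ)
    {f : ℝ → E → F} {Q : Opens (ℝ × E)} {q : ℝ≥0∞}
    (hf : MemLp (uncurry f) q (volume.restrict (Q : Set (ℝ × E)))) :
    MemLp (uncurry (a • stPull β γ t₀ x₀ f)) q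
      (volume.restrict ((stPreimage β γ t₀ x₀ Q : Opens (ℝ × E)) : Set (ℝ × E))) := by
  have e : uncurry (a • stPull β γ t₀ x₀ f) = a • (uncurry f ∘ stAffine β γ t₀ x₀) := by
    funext z; rfl
  rw [e, coe_stPreimage]
  refine MemLp.const_smul ?_ a
  have hmap := map_stAffine_volume_restrict_preimage hβ hγ t₀ x₀ (Q : Set (ℝ × E))
  have hk : ENNReal.ofReal (β * γ ^ finrank ℝ E)⁻¹ ≠ ∞ := ENNReal.ofReal_ne_top
  have hf' : MemLp (uncurry f) q
      (Measure.map (stAffine β γ t₀ x₀) (volume.restrict (stAffine β γ t₀ x₀ ⁻¹' (Q : Set (ℝ × E))))) := by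
    rw [hmap]
    exact hf.smul_measure hk
  exact hf'.comp_of_map (measurable_stAffine β γ t₀ x₀).aemeasurable

end Transport

section Reduction

/-- **The zoom maps `closure Q₁(0)` into `Φ⁻¹(Q)` when `closure Q_r(z) ⊆ Q`**,
`Φ = stAffine r² r t x`, `z = (t, x)` (`Φ(Q₁(0)) = Q_r(z)` and `Φ` is continuous). [folklore] -/
theorem closure_parabolicCylinder_one_subset_stPreimage {r : ℝ} (hr : 0 < r)
    {z : ℝ × EuclideanSpace ℝ (Fin 3)} {Q : Opens (ℝ × EuclideanSpace ℝ (Fin 3))}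
    (hcl : closure (parabolicCylinder r z) ⊆ (Q : Set (ℝ × EuclideanSpace ℝ (Fin 3)))) :
    closure (parabolicCylinder 1 (0 : ℝ × EuclideanSpace ℝ (Fin 3))) ⊆
      ((stPreimage (r ^ 2) r z.1 z.2 Q : Opens (ℝ × EuclideanSpace ℝ (Fin 3))) :
        Set (ℝ × EuclideanSpace ℝ (Fin 3))) := by
  rw [coe_stPreimage, ← image_subset_iff]
  have hz : stAffine (r ^ 2) r z.1 z.2 (0 : ℝ × EuclideanSpace ℝ (Fin 3)) = z :=
    Prod.ext (by simp [stAffine]) (by simp [stAffine])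
  have hpre : stAffine (r ^ 2) r z.1 z.2 ⁻¹' parabolicCylinder r z =
      parabolicCylinder 1 (0 : ℝ × EuclideanSpace ℝ (Fin 3)) := by
    have := LocalTypeIScaling.stAffine_preimage_parabolicCylinder hr z.1 z.2 1 0
    rwa [mul_one, hz] at this
  have hsurj : Surjective (stAffine (r ^ 2) r z.1 z.2) :=
    (stAffineHomeomorph (by positivity : r ^ 2 ≠ 0) hr.ne' z.1 z.2).surjective
  have himg : stAffine (r ^ 2) r z.1 z.2 '' parabolicCylinder 1 (0 : ℝ × EuclideanSpace ℝ (Fin 3)) =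
      parabolicCylinder r z := by
    rw [← hpre, image_preimage_eq _ hsurj]
  calc stAffine (r ^ 2) r z.1 z.2 '' closure (parabolicCylinder 1 (0 : ℝ × EuclideanSpace ℝ (Fin 3)))
      ⊆ closure (stAffine (r ^ 2) r z.1 z.2 '' parabolicCylinder 1 (0 : ℝ × EuclideanSpace ℝ (Fin 3))) :=
        image_closure_subset_closure_image (continuous_stAffine _ _ _ _)
    _ = closure (parabolicCylinder r z) := by rw [himg]
    _ ⊆ (Q : Set (ℝ × EuclideanSpace ℝ (Fin 3))) := hcl

/-- **Reduction of the local-energy estimate to unit scale** (Robinson–Rodrigo–Sadowski 2016,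
p. 252: "It suffices to prove the estimate with `r = 1`, the result for general `r` following
by rescaling"): given the estimate on `Q₁(0)`, the estimate on every `Q_r(z)` follows by
applying it to the Navier–Stokes zoom `u_r(s, y) = r u(t + r²s, x + ry)`, `p_r = r² p ∘ Φ`,
`f_r = r³ f ∘ Φ` (a suitable weak solution with the same viscosity on `Φ⁻¹(Q)`,
`IsSuitableWeakSolutionOn.stRescale`), whose scaled quantities at `(ρ, 0)` are those of `u`
at `(ρ r, z)`. [cite: RobinsonRodrigoSadowski2016, (16.13) and p. 252] -/
theorem localEnergyEstimate_of_unitScale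
    (H : ∃ κ₁ κ₂ κ₃ κ₄ : ℝ≥0, ∀ (Q : Opens (ℝ × EuclideanSpace ℝ (Fin 3))) (q : ℝ)
      (f u : ℝ → EuclideanSpace ℝ (Fin 3) → EuclideanSpace ℝ (Fin 3))
      (p : ℝ → EuclideanSpace ℝ (Fin 3) → ℝ)
      (G : ℝ → EuclideanSpace ℝ (Fin 3) → EuclideanSpace ℝ (Fin 3) →L[ℝ] EuclideanSpace ℝ (Fin 3)),
      IsSuitableWeakSolutionOn Q 1 f u p → 5 / 2 < q →
      MemLp (uncurry f) (ENNReal.ofReal q)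
        (volume.restrict (Q : Set (ℝ × EuclideanSpace ℝ (Fin 3)))) →
      HasWeakSpatialGradientOn Q u G →
      closure (parabolicCylinder 1 (0 : ℝ × EuclideanSpace ℝ (Fin 3))) ⊆
        (Q : Set (ℝ × EuclideanSpace ℝ (Fin 3))) →
      ∀ θ : ℝ, 0 < θ → θ ≤ 1 / 2 →
        cknAEss θ 0 u + cknE θ 0 G ≤
          κ₁ * ENNReal.ofReal (θ ^ 2) * (cknAEss 1 0 u + cknE 1 0 G) +
          κ₂ * ENNReal.ofReal ((θ ^ 6)⁻¹) * (cknAEss 1 0 u * cknE 1 0 G) +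
          κ₃ * ENNReal.ofReal ((θ ^ 6)⁻¹) * cknD 1 0 p ^ (4 / 3 : ℝ) +
          κ₄ * ENNReal.ofReal ((θ ^ 4)⁻¹) * cknF q 1 0 f ^ (2 / q)) :
    localEnergyEstimate := by
  obtain ⟨κ₁, κ₂, κ₃, κ₄, H⟩ := H
  refine ⟨κ₁, κ₂, κ₃, κ₄, fun Q q f u p G hsol hq hf hG z r θ hr hθ hθ' hcl => ?_⟩
  have hq0 : 0 ≤ q := by linarith
  -- the zoomed data
  set Q' := stPreimage (r ^ 2) r z.1 z.2 Q with hQ'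
  set u' := r • stPull (r ^ 2) r z.1 z.2 u with hu'
  set p' := r ^ 2 • stPull (r ^ 2) r z.1 z.2 p with hp'
  set f' := r ^ 3 • stPull (r ^ 2) r z.1 z.2 f with hf'
  set G' := r ^ 2 • stPull (r ^ 2) r z.1 z.2 G with hG'
  have hsol' : IsSuitableWeakSolutionOn Q' 1 f' u' p' := by
    have := hsol.stRescale (α := r) (β := r ^ 2) (γ := r) hr hr (by ring) z.1 z.2
    rwa [show r * 1 / r = 1 by field_simp, show r ^ 2 * r = r ^ 3 by ring] at this
  have hf'' : MemLp (uncurry f') (ENNReal.ofReal q)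
      (volume.restrict (Q' : Set (ℝ × EuclideanSpace ℝ (Fin 3)))) :=
    hf.smul_uncurry_stPull (by positivity) hr z.1 z.2 (r ^ 3)
  have hG'' : HasWeakSpatialGradientOn Q' u' G' := by
    have := hG.stRescale r (by positivity : 0 < r ^ 2) hr z.1 z.2
    rwa [← sq] at this
  have hcl' := closure_parabolicCylinder_one_subset_stPreimage hr hcl
  have key := H Q' q f' u' p' G' hsol' hq hf'' hG'' hcl' θ hθ hθ'
  -- transport the quantities back
  have hz : stAffine (r ^ 2) r z.1 z.2 (0 : ℝ × EuclideanSpace ℝ (Fin 3)) = z :=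
    Prod.ext (by simp [stAffine]) (by simp [stAffine])
  have hA : ∀ ρ : ℝ, 0 < ρ → cknAEss ρ 0 u' = cknAEss (ρ * r) z u := fun ρ hρ => by
    rw [hu', cknAEss_nsZoom hr hρ z.1 z.2 0 u, hz, mul_comm]
  have hE : ∀ ρ : ℝ, 0 < ρ → cknE ρ 0 G' = cknE (ρ * r) z G := fun ρ hρ => by
    rw [hG', cknE_nsZoom hr hρ z.1 z.2 0 G, hz, mul_comm]
  have hD : cknD 1 0 p' = cknD r z p := by
    rw [hp', cknD_nsZoom hr one_pos z.1 z.2 0 p, hz, mul_one]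
  have hF : cknF q 1 0 f' = cknF q r z f := by
    rw [hf', cknF_nsZoom hr one_pos hq0 z.1 z.2 0 f, hz, mul_one]
  rw [hA θ hθ, hE θ hθ, hA 1 one_pos, hE 1 one_pos, one_mul, hD, hF] at key
  exact key

end Reduction

end Literature.Analysis.FluidPDE
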